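import Summits.MatrixMultiplication.OmegaCensus.STPPVosperTableRatio
import Summits.MatrixMultiplication.OmegaCensus.STPP222SqSymmetry

/-!
# ω-census (abelian STPP census): the DOUBLE Vosper table law at `ℤ₆₁` — two tight readings of one block with exceptional ratio `±c` (kernel, general form)

HONEST FRAMING (pub-omega census; verbatim): lottery ticket; floor = certified bounds/negative ranges.
Census STRUCTURE (seat pub-omega-stpp-1 gen 29, 2026-08-28), family (b2).  The general form of `STPPVosperClash222234235.lean`: a THEOREM FILTER for ℤ₆₁
patterns whose single window tables do not close; nothing here is progress on `ω`.

## Statement (`no_isSTPP_of_two_tight_tables`)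

STPP family `(A_k,B_k,C_k)_{k<N}` with non-empty sets in `ℤ₆₁`, block `i` with another block, `a = |Aᵢ|, b = |Bᵢ|, c = |Cᵢ|`, `vol = abc`.  Suppose block `i` is
N18-tight in BOTH readings
* `(a,b,c)`: `z = Σ_{k≠i}|A_k||C_k|`, `L = Σ_{k≠i}|B_k||C_k|`, `z + b + vol + a + L = 63`, table `(n, m, b)` with `m = L + a − 1`, `n = vol + m`;
* `(a,c,b)` (the family `(−A, −C, −B)`, `STPP222SqNeg.isSTPP_negSwap`): `z′ = Σ_{k≠i}|A_k||B_k|`, `L′ = Σ_{k≠i}|C_k||B_k|`, `z′ + c + vol + a + L′ = 63`,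
  table `(n′, m′, c)` with `m′ = L′ + a − 1`, `n′ = vol + m′`;
with all of `a, b, c, z, L, z′, L′ ≥ 2`, and that BOTH `ℕ`-tables have target `{0, 1, 60, c₁, c₂}` where `c₁ + c₂ ≡ 0`, `c₁ ≢ 0 (mod 61)` (one exceptional
ratio `±c₁`).  Then the family does not exist.

## Proof

`tight_ratio_val_mem` twice: `Aᵢ` an `a`-progression of step `e`, `Bᵢ` a `b`-progression of step `e′`, `e/e′ ∈ {±1, ±c₁}`; `−Aᵢ` an `a`-progression of step
`f` (so `f = ±e`, `STPPVosperPositionLemmas.eq_or_eq_neg_of_mutual_apFinset_subset`), `−Cᵢ` a `c`-progression of step `f′`, `f/f′ ∈ {±1, ±c₁}`.  Signs through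
squares: `e² = c₁²e′²` or `e = ±e′`, etc.  Three TPP words at `(i,i,i)`: `e = ±e′` (pair `Aᵢ,Bᵢ`), `e = ±f′` (pair `Aᵢ,Cᵢ`), `e′ = ±f′` (pair `Bᵢ,Cᵢ`, from
`c₁²e′² = c₁²f′²`).

References: A. G. Vosper, J. London Math. Soc. 31 (1956); M. B. Nathanson, *Additive Number Theory: Inverse Problems*, GTM 165, Thm 2.7; H. Cohn,
R. Kleinberg, B. Szegedy, C. Umans, FOCS 2005 (arXiv:math/0511460), Def. 5.1.
-/

open Finset
open scoped Pointwise

namespace Summit.MatrixMultiplication.OmegaCensus.CubeNB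

open Literature.Computability.AlgebraicComplexity
open Literature.Combinatorics.Additive
open Summit.MatrixMultiplication.OmegaCensus.STPPKneser

/-- **The double Vosper table law at `ℤ₆₁` (kernel, general block).**  See the module docstring. [cite: CohnKleinbergSzegedyUmans2005, Def. 5.1]
[cite: Vosper1956, main theorem; Nathanson1996, Thm 2.7] -/
theorem no_isSTPP_of_two_tight_tables {N : ℕ} (A B C : Fin N → Finset (ZMod 61)) (hS : IsSTPP A B C)
    (hA : ∀ k, (A k).Nonempty) (hB : ∀ k, (B k).Nonempty) (hC : ∀ k, (C k).Nonempty)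
    (i : Fin N) (hI : ((univ : Finset (Fin N)).erase i).Nonempty)
    {a b c vol z L m n z' L' m' n' c₁ c₂ : ℕ} (ha : #(A i) = a) (hb : #(B i) = b) (hc : #(C i) = c) (hvol : a * b * c = vol)
    (hz : ∑ k ∈ univ.erase i, #(A k) * #(C k) = z) (hL : ∑ k ∈ univ.erase i, #(B k) * #(C k) = L)
    (hz' : ∑ k ∈ univ.erase i, #(A k) * #(B k) = z') (hL' : ∑ k ∈ univ.erase i, #(C k) * #(B k) = L')
    (h2a : 2 ≤ a) (h2b : 2 ≤ b) (h2c : 2 ≤ c) (h2z : 2 ≤ z) (h2L : 2 ≤ L) (h2z' : 2 ≤ z') (h2L' : 2 ≤ L')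
    (htight : z + b + vol + a + L = 63) (htight' : z' + c + vol + a + L' = 63)
    (hm : L + a = m + 1) (hn : vol + m = n) (hm' : L' + a = m' + 1) (hn' : vol + m' = n')
    (hc12 : ((c₁ : ℕ) : ZMod 61) + ((c₂ : ℕ) : ZMod 61) = 0) (hc1 : ((c₁ : ℕ) : ZMod 61) ≠ 0)
    (htable : ∀ j < 61, ∀ t < 61, (∀ i' < m, (t + j * i') % 61 < n) →
      (∀ k < m, b ∣ (t + j * k) % 61 - #((range m).filter fun i' => (t + j * i') % 61 < (t + j * k) % 61)) →
      j ∈ ({0, 1, 60, c₁, c₂} : Finset ℕ))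
    (htable' : ∀ j < 61, ∀ t < 61, (∀ i' < m', (t + j * i') % 61 < n') →
      (∀ k < m', c ∣ (t + j * k) % 61 - #((range m').filter fun i' => (t + j * i') % 61 < (t + j * k) % 61)) →
      j ∈ ({0, 1, 60, c₁, c₂} : Finset ℕ)) : False := by
  have h61 : (61 : ZMod 61) = 0 := by decide
  have h60 : ((60 : ℕ) : ZMod 61) = -1 := by decide
  haveI : Fact (Nat.Prime 61) := ⟨prime_61⟩
  -- Reading (a,b,c)
  have hvolA : #(A i) * #(B i) * #(C i) = vol := by rw [ha, hb, hc, hvol]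
  obtain ⟨e, e', α, β, he, he', hα, hβ, hr1⟩ := tight_ratio_val_mem A B C hS hA hB hC i hI ha hb hvolA hz hL h2a h2b h2z h2L
    htight hm hn htable
  -- Reading (a,c,b): the family (−A, −C, −B)
  set A' : Fin N → Finset (ZMod 61) := fun t => (A t).image Neg.neg with hA'
  set B' : Fin N → Finset (ZMod 61) := fun t => (C t).image Neg.neg with hB'
  set C' : Fin N → Finset (ZMod 61) := fun t => (B t).image Neg.neg with hC'
  have hS' : IsSTPP A' B' C' := STPP222SqNeg.isSTPP_negSwap hS
  have hcA' : ∀ t, #(A' t) = #(A t) := fun t => Finset.card_image_of_injective _ neg_injective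
  have hcB' : ∀ t, #(B' t) = #(C t) := fun t => Finset.card_image_of_injective _ neg_injective
  have hcC' : ∀ t, #(C' t) = #(B t) := fun t => Finset.card_image_of_injective _ neg_injective
  have hAne' : ∀ t, (A' t).Nonempty := fun t => (hA t).image _
  have hBne' : ∀ t, (B' t).Nonempty := fun t => (hC t).image _
  have hCne' : ∀ t, (C' t).Nonempty := fun t => (hB t).image _
  have ha' : #(A' i) = a := by rw [hcA', ha]
  have hb'' : #(B' i) = c := by rw [hcB', hc]
  have hvol' : #(A' i) * #(B' i) * #(C' i) = vol := by rw [hcA', hcB', hcC', ha, hb, hc, ← hvol]; ring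
  have hzz : ∑ k ∈ univ.erase i, #(A' k) * #(C' k) = z' := by simp only [hcA', hcC']; exact hz'
  have hLL : ∑ k ∈ univ.erase i, #(B' k) * #(C' k) = L' := by simp only [hcB', hcC']; exact hL'
  obtain ⟨f, f', α', β', hf, hf', hα', hβ', hr2⟩ := tight_ratio_val_mem A' B' C' hS' hAne' hBne' hCne' i hI ha' hb'' hvol' hzz hLL
    h2a h2c h2z' h2L' htight' hm' hn' htable'
  -- f = ±e: both are steps of the a-progression Aᵢ (a ≤ 31)
  obtain ⟨a₀, rfl⟩ : ∃ a₀, a = a₀ + 1 := ⟨a - 1, by omega⟩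
  have hbc4 : 4 ≤ b * c := by nlinarith
  have ha31 : 2 * (a₀ + 1) ≤ 61 + 1 := by
    have h4a : (a₀ + 1) * 4 ≤ vol := by rw [← hvol, mul_assoc]; exact Nat.mul_le_mul_left _ hbc4
    omega
  have hfe : f = e ∨ f = -e := by
    have hneg : A' i = -(A i) := rfl
    rw [hα, neg_apFinset, hα'] at hneg
    -- hneg : apFinset α' f (a₀+1) = apFinset (−α − a₀•e) e (a₀+1)
    have hsize : (a₀ + 1 - 1) * (a₀ + 1 - 1) < (a₀ + 1 - 1) * (a₀ + 1 - 1) * (61 - 1) := by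
      have hx : 0 < (a₀ + 1 - 1) * (a₀ + 1 - 1) := Nat.mul_pos (by omega) (by omega)
      generalize (a₀ + 1 - 1) * (a₀ + 1 - 1) = X at hx ⊢
      omega
    exact eq_or_eq_neg_of_mutual_apFinset_subset hf he (by omega) ha31 hneg.le hneg.symm.le hsize
  -- elements
  have hαmem : α ∈ A i := by rw [hα]; exact mem_apFinset.2 ⟨0, by omega, by simp⟩
  have hαe : α + e ∈ A i := by rw [hα]; exact mem_apFinset.2 ⟨1, by omega, by simp⟩
  have hβmem : β ∈ B i := by rw [hβ]; exact mem_apFinset.2 ⟨0, by omega, by simp⟩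
  have hβe : β + e' ∈ B i := by rw [hβ]; exact mem_apFinset.2 ⟨1, by omega, by simp⟩
  have hγmem : -β' ∈ C i := by
    have h : β' ∈ B' i := by rw [hβ']; exact mem_apFinset.2 ⟨0, by omega, by simp⟩
    obtain ⟨x, hx, hxβ⟩ := Finset.mem_image.1 h
    have : x = -β' := by rw [← hxβ, neg_neg]
    exact this ▸ hx
  have hγf : -β' - f' ∈ C i := by
    have h : β' + f' ∈ B' i := by rw [hβ']; exact mem_apFinset.2 ⟨1, by omega, by simp⟩
    obtain ⟨x, hx, hxβ⟩ := Finset.mem_image.1 h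
    have : x = -β' - f' := by rw [show -β' - f' = -(β' + f') by ring, ← hxβ, neg_neg]
    exact this ▸ hx
  -- the three clash words of block i
  have hAB : ¬ (e = e' ∨ e = -e') := by
    rintro (h | h)
    · have hrel : (α - (α + e)) + ((β + e') - β) + ((-β') - (-β')) = 0 := by rw [h]; ring
      obtain ⟨-, -, -, h4, -⟩ := hS i i i (α + e) hαe α hαmem β hβmem (β + e') hβe (-β') hγmem (-β') hγmem hrel
      exact he' (by linear_combination h4.symm)
    · have hrel : ((α + e) - α) + ((β + e') - β) + ((-β') - (-β')) = 0 := by rw [h]; ring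
      obtain ⟨-, -, -, h4, -⟩ := hS i i i α hαmem (α + e) hαe β hβmem (β + e') hβe (-β') hγmem (-β') hγmem hrel
      exact he' (by linear_combination h4.symm)
  have hAC : ¬ (e = f' ∨ e = -f') := by
    rintro (h | h)
    · have hrel : ((α + e) - α) + (β - β) + ((-β' - f') - (-β')) = 0 := by rw [h]; ring
      obtain ⟨-, -, h3, -, -⟩ := hS i i i α hαmem (α + e) hαe β hβmem β hβmem (-β') hγmem (-β' - f') hγf hrel
      exact he (by linear_combination h3.symm)
    · have hrel : ((α + e) - α) + (β - β) + ((-β') - (-β' - f')) = 0 := by rw [h]; ring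
      obtain ⟨-, -, h3, -, -⟩ := hS i i i α hαmem (α + e) hαe β hβmem β hβmem (-β' - f') hγf (-β') hγmem hrel
      exact he (by linear_combination h3.symm)
  have hBC : ¬ (e' = f' ∨ e' = -f') := by
    rintro (h | h)
    · have hrel : (α - α) + ((β + e') - β) + ((-β' - f') - (-β')) = 0 := by rw [h]; ring
      obtain ⟨-, -, -, h4, -⟩ := hS i i i α hαmem α hαmem β hβmem (β + e') hβe (-β') hγmem (-β' - f') hγf hrel
      exact he' (by linear_combination h4.symm)
    · have hrel : (α - α) + ((β + e') - β) + ((-β') - (-β' - f')) = 0 := by rw [h]; ring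
      obtain ⟨-, -, -, h4, -⟩ := hS i i i α hαmem α hαmem β hβmem (β + e') hβe (-β' - f') hγf (-β') hγmem hrel
      exact he' (by linear_combination h4.symm)
  -- ratio values to equations; signs through squares
  set K : ZMod 61 := ((c₁ : ℕ) : ZMod 61) with hK
  have hc2 : ((c₂ : ℕ) : ZMod 61) = -K := by linear_combination hc12
  have key : ∀ {x x' : ZMod 61}, x' ≠ 0 → ∀ d : ℕ, (x'⁻¹ * x).val = d → x = ((d : ℕ) : ZMod 61) * x' := by
    intro x x' hx' d hd
    have hxx : x' * (x'⁻¹ * x) = x := by rw [← mul_assoc, mul_inv_cancel₀ hx', one_mul]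
    rw [← hxx, ← hd, ZMod.natCast_zmod_val, mul_comm]
  have sq_imp : ∀ {x y : ZMod 61}, x ^ 2 = y ^ 2 → x = y ∨ x = -y := by
    intro x y h
    have h0 : (x - y) * (x + y) = 0 := by linear_combination h
    rcases mul_eq_zero.1 h0 with h1 | h1
    · left; linear_combination h1
    · right; linear_combination h1
  have cases_of_val : ∀ {x x' : ZMod 61}, x' ≠ 0 → x ≠ 0 →
      (x'⁻¹ * x).val ∈ ({0, 1, 60, c₁, c₂} : Finset ℕ) → (x = x' ∨ x = -x') ∨ x ^ 2 = K ^ 2 * x' ^ 2 := by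
    intro x x' hx' hx h
    simp only [Finset.mem_insert, Finset.mem_singleton] at h
    rcases h with h | h | h | h | h
    · exact absurd ((ZMod.val_eq_zero _).1 h) (mul_ne_zero (inv_ne_zero hx') hx)
    · left; left; have h' := key hx' 1 h; rw [Nat.cast_one, one_mul] at h'; exact h'
    · left; right; have h' := key hx' 60 h; rw [h60] at h'; linear_combination h'
    · right; have h' := key hx' c₁ h; rw [h']; ring
    · right; have h' := key hx' c₂ h; rw [h', hc2]; ring
  have hfe2 : f ^ 2 = e ^ 2 := by
    rcases hfe with h | h
    · rw [h]
    · rw [h]; ring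
  rcases cases_of_val he' he hr1 with hab | he2
  · exact hAB hab
  rcases cases_of_val hf' hf hr2 with hff | hf2
  · have hff2 : f ^ 2 = f' ^ 2 := by
      rcases hff with h | h
      · rw [h]
      · rw [h]; ring
    exact hAC (sq_imp (by rw [← hff2, hfe2]))
  · have hKK : K ^ 2 * e' ^ 2 = K ^ 2 * f' ^ 2 := by rw [← he2, ← hf2, hfe2]
    have hK0 : K ^ 2 ≠ 0 := pow_ne_zero 2 hc1
    exact hBC (sq_imp (mul_left_cancel₀ hK0 hKK))

end Summit.MatrixMultiplication.OmegaCensus.CubeNB
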